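import Literature.Analysis.FluidPDE.TaoCascadeODE
import Mathlib.Analysis.Convex.SpecificFunctions.Basic
import HarnessLib

/-!
# Tao's cascade ODE: the blow-up dynamics (Props. 6.3, 6.4) and the reduction of Thm. 6.2 to them

T. Tao, *Finite time blowup for an averaged three-dimensional Navier–Stokes equation*,
J. Amer. Math. Soc. 29 (2016), 601–674 (arXiv:1402.0290v3), §6.2–6.3, pp. 31–33. This file is the
first layer *below* the named fact `TaoCascade.noGlobalODESolution` (= Thm. 6.2, file
`TaoCascadeODE.lean`) in the printed proof:

* Thm. 6.2 ⇐ **Prop. 6.3 (blow-up dynamics)** [§6.2, p. 32: "Let us now see how the above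
  proposition implies Theorem 6.2"]: proved here as `noGlobalODESolution_of_blowupDynamics`;
* Prop. 6.3 ⇐ **Prop. 6.4 (blow-up dynamics, inductive case)** by induction on `N` [§6.3, p. 32:
  "We do so by an induction on `N`. The base case `N = n₀` is easy: one sets `t_{n₀} = 0` and
  `e_{n₀} = 1` … Clearly, Proposition 6.4 implies Proposition 6.3"]: proved here as
  `blowupDynamics_of_blowupDynamicsStep`;
* Prop. 6.4 ⇐ Prop. 6.5 (rescaled inductive step, §6.4) and the proof of Prop. 6.5 (§6.5–6.7)
  are NOT here (see `TaoCascadeRescaled.lean` when it lands).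

Props. 6.3 and 6.4 themselves are vendored as the named facts `blowupDynamics` and
`blowupDynamicsStep` (not asserted).

## Packaging of (vi)–(ix), (6.9)–(6.25) and (vii′)–(ix′), (6.26)–(6.40)

The checkpoint times `t_{n₀}, …, t_N` and amplitudes `e_{n₀}, …, e_N` are total functions
`t e : ℤ → ℝ` (only the values on `[n₀, N]` are constrained). The printed bounds split into

* `StateBounds … n s a` = the transition-state bounds (6.13)–(6.18) at scale `n`, checkpoint time
  `s = t_n` and amplitude `a = e_n > 0` (those of (viii) that involve the single scale `n`, plus
  `E_{n-1}(t_n)`), required for `n₀ ≤ n ≤ N`;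
* `StepBounds … n s′ s a′ a` = the bounds relating scale `n-1` (time `s′ = t_{n-1}`, amplitude
  `a′ = e_{n-1}`) to scale `n` (time `s = t_n > s′`, amplitude `a = e_n`): amplitude stability
  (6.11), lifespan (6.12), the "additional bounds" (6.19)–(6.22) and the energy estimates (ix)
  (6.23)–(6.25) on `[t_{n-1}, t_n]`, required for `n₀ < n ≤ N`;
* `BlowupCheckpoints … N … t e` = (6.9) `t_{n₀} = 0`, (6.10) `e_{n₀} = 1`, `StateBounds` on
  `[n₀, N]`, `StepBounds` on `(n₀, N]`; strict monotonicity `t_{n₀} < … < t_N` and positivity of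
  the `e_n` are the fields `StepBounds.lt`, `StateBounds.pos`.

With this split the conclusion (vii′)–(ix′) of Prop. 6.4 is literally
`StateBounds … (N+1) t_{N+1} e_{N+1} ∧ StepBounds … (N+1) t_N t_{N+1} e_N e_{N+1}`.

Reading of constants: `10^{-5} ↦ 1/10^5`, `K^{-10} ↦ (K^10)⁻¹`, `exp(±K^{10}) ↦ Real.exp (±K^10)`,
`(1+ε₀)^{x}` for non-integral or sign-carrying exponents ↦ `Real.rpow`; "for all `m ≥ 2`"
(resp. `m ≥ 1`) in (6.23), (6.25) ranges over natural numbers `m`.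

**Typo in the source.** (6.36)–(6.37) print `X_{3,N}(t_{N+1}) ≥ exp(K⁹) ε² e_{N+1}^2` and
`≤ exp(K^{10}) ε² e_{N+1}^2`; since Prop. 6.4 is the inductive case of Prop. 6.3, whose
(6.21)–(6.22) read `e_n` (first power), and since the rescaling (6.60)–(6.61)/(6.74)–(6.75) of
§6.4 produces the first power, we read `e_{N+1}` (this is what `StepBounds.x3_prev_ge/le` say).

## References

* T. Tao, J. Amer. Math. Soc. 29 (2016), 601–674, §6.1 Thm. 6.2, §6.2 Prop. 6.3 (6.9)–(6.25) and
  the paragraph "Let us now see how the above proposition implies Theorem 6.2" (p. 32), §6.3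
  Prop. 6.4 (6.26)–(6.40). [`Tao2016AveragedNS`]
-/

noncomputable section

open Set

namespace Literature.Analysis.FluidPDE

namespace TaoCascade

/-! ## The checkpoint bounds of Proposition 6.3 -/

/-- **Transition-state bounds (viii), (6.13)–(6.18), of Tao's Prop. 6.3** at scale `n`, checkpoint
time `s = t_n` and amplitude `a = e_n > 0`, for the modes `X_{1..4,n} ↦ X 0 n, …, X 3 n` and the
combined energies `E_n` of the system (6.0)–(6.8):
(6.13) `X_{1,n}(t_n) = e_n`; (6.14) `|X_{2,n}(t_n)| ≤ 10⁻⁵ ε e_n`;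
(6.15) `|X_{3,n}(t_n)| ≤ 10⁻⁵ exp(-K^{10}) ε² e_n`; (6.16) `X_{3,n}(t_n) ≥ -(1+ε₀)^{-n₀/4} e_n`;
(6.17) `|X_{4,n}(t_n)| ≤ K^{-10} e_n`; (6.18) `E_{n-1}(t_n) ≤ K^{-20} e_n²`.
[cite: Tao2016AveragedNS, §6.2 Prop. 6.3 (6.13)–(6.18)] -/
structure StateBounds (ε₀ K ε : ℝ) (n₀ : ℤ) (X : Fin 4 → ℤ → ℝ → ℝ) (E : ℤ → ℝ → ℝ) (n : ℤ)
    (s a : ℝ) : Prop where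
  /-- The amplitude `e_n` is positive. -/
  pos : 0 < a
  /-- (6.13) `X_{1,n}(t_n) = e_n`. -/
  x1_eq : X 0 n s = a
  /-- (6.14) `|X_{2,n}(t_n)| ≤ 10⁻⁵ ε e_n`. -/
  x2_abs_le : |X 1 n s| ≤ 1 / 10 ^ 5 * ε * a
  /-- (6.15) `|X_{3,n}(t_n)| ≤ 10⁻⁵ exp(-K^{10}) ε² e_n`. -/
  x3_abs_le : |X 2 n s| ≤ 1 / 10 ^ 5 * Real.exp (-K ^ 10) * ε ^ 2 * a
  /-- (6.16) `X_{3,n}(t_n) ≥ -(1+ε₀)^{-n₀/4} e_n`. -/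
  x3_ge : -((1 + ε₀) ^ (-(n₀ : ℝ) / 4) * a) ≤ X 2 n s
  /-- (6.17) `|X_{4,n}(t_n)| ≤ K^{-10} e_n`. -/
  x4_abs_le : |X 3 n s| ≤ (K ^ 10)⁻¹ * a
  /-- (6.18) `E_{n-1}(t_n) ≤ K^{-20} e_n²`. -/
  energy_prev_le : E (n - 1) s ≤ (K ^ 20)⁻¹ * a ^ 2

/-- **Scale-evolution, additional and energy bounds (vii), (6.19)–(6.22), (ix) of Tao's Prop. 6.3**
for the passage from scale `n-1` (checkpoint time `s′ = t_{n-1}`, amplitude `a′ = e_{n-1}`) to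
scale `n` (time `s = t_n`, amplitude `a = e_n`): `t_{n-1} < t_n`; amplitude stability (6.11)
`(1+ε₀)^{-1/100} e_{n-1} ≤ e_n ≤ (1+ε₀)^{1/100} e_{n-1}`; lifespan (6.12)
`(1/100)(1+ε₀)^{-5(n-1)/2} e_{n-1}⁻¹ ≤ t_n - t_{n-1} ≤ 100 (1+ε₀)^{-5(n-1)/2} e_{n-1}⁻¹`;
(6.19)–(6.22) `10⁻⁵ ε e_n ≤ X_{2,n-1}(t_n) ≤ 10⁵ ε e_n`,
`exp(K⁹) ε² e_n ≤ X_{3,n-1}(t_n) ≤ exp(K^{10}) ε² e_n`; and for `t_{n-1} ≤ t ≤ t_n`: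
(6.23) `E_{n-m}(t) ≤ K^{-10} (1+ε₀)^{m/10} e_{n-1}²` for all `m ≥ 2`, (6.24)
`E_{n-1}(t) + E_n(t) ≤ e_{n-1}²`, (6.25) `E_{n+m}(t) ≤ K^{-30} (1+ε₀)^{-10m} e_{n-1}²` for all `m ≥ 1`.
(The same displays, at `n = N+1`, are (6.26)–(6.27), (6.34)–(6.40) of Prop. 6.4; see the module
docstring for the misprint `e_{N+1}^2` in (6.36)–(6.37).)
[cite: Tao2016AveragedNS, §6.2 Prop. 6.3 (6.11)–(6.12), (6.19)–(6.25)] -/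
structure StepBounds (ε₀ K ε : ℝ) (X : Fin 4 → ℤ → ℝ → ℝ) (E : ℤ → ℝ → ℝ) (n : ℤ)
    (s' s a' a : ℝ) : Prop where
  /-- `t_{n-1} < t_n`. -/
  lt : s' < s
  /-- (6.11), lower: `(1+ε₀)^{-1/100} e_{n-1} ≤ e_n`. -/
  amp_ge : (1 + ε₀) ^ (-(1 : ℝ) / 100) * a' ≤ a
  /-- (6.11), upper: `e_n ≤ (1+ε₀)^{1/100} e_{n-1}`. -/
  amp_le : a ≤ (1 + ε₀) ^ ((1 : ℝ) / 100) * a'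
  /-- (6.12), lower: `(1/100)(1+ε₀)^{-5(n-1)/2} e_{n-1}⁻¹ ≤ t_n - t_{n-1}`. -/
  life_ge : 1 / 100 * (1 + ε₀) ^ (-(5 : ℝ) * (n - 1) / 2) * a'⁻¹ ≤ s - s'
  /-- (6.12), upper: `t_n - t_{n-1} ≤ 100 (1+ε₀)^{-5(n-1)/2} e_{n-1}⁻¹`. -/
  life_le : s - s' ≤ 100 * (1 + ε₀) ^ (-(5 : ℝ) * (n - 1) / 2) * a'⁻¹
  /-- (6.19) `X_{2,n-1}(t_n) ≥ 10⁻⁵ ε e_n`. -/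
  x2_prev_ge : 1 / 10 ^ 5 * ε * a ≤ X 1 (n - 1) s
  /-- (6.20) `X_{2,n-1}(t_n) ≤ 10⁵ ε e_n`. -/
  x2_prev_le : X 1 (n - 1) s ≤ 10 ^ 5 * ε * a
  /-- (6.21) `X_{3,n-1}(t_n) ≥ exp(K⁹) ε² e_n`. -/
  x3_prev_ge : Real.exp (K ^ 9) * ε ^ 2 * a ≤ X 2 (n - 1) s
  /-- (6.22) `X_{3,n-1}(t_n) ≤ exp(K^{10}) ε² e_n`. -/
  x3_prev_le : X 2 (n - 1) s ≤ Real.exp (K ^ 10) * ε ^ 2 * a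
  /-- (6.23): for `m ≥ 2` and `t_{n-1} ≤ t ≤ t_n`, `E_{n-m}(t) ≤ K^{-10} (1+ε₀)^{m/10} e_{n-1}²`. -/
  en_before : ∀ m : ℕ, 2 ≤ m → ∀ t ∈ Icc s' s,
    E (n - m) t ≤ (K ^ 10)⁻¹ * (1 + ε₀) ^ ((m : ℝ) / 10) * a' ^ 2
  /-- (6.24): for `t_{n-1} ≤ t ≤ t_n`, `E_{n-1}(t) + E_n(t) ≤ e_{n-1}²`. -/
  en_during : ∀ t ∈ Icc s' s, E (n - 1) t + E n t ≤ a' ^ 2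
  /-- (6.25): for `m ≥ 1` and `t_{n-1} ≤ t ≤ t_n`, `E_{n+m}(t) ≤ K^{-30} (1+ε₀)^{-10m} e_{n-1}²`. -/
  en_after : ∀ m : ℕ, 1 ≤ m → ∀ t ∈ Icc s' s,
    E (n + m) t ≤ (K ^ 30)⁻¹ * (1 + ε₀) ^ (-(10 : ℝ) * m) * a' ^ 2

/-- **The conclusion (vi)–(ix), (6.9)–(6.25), of Tao's Prop. 6.3 (blow-up dynamics)** up to level
`N ≥ n₀`, for checkpoint times `t_{n₀}, …, t_N` and amplitudes `e_{n₀}, …, e_N` (total functions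
`t e : ℤ → ℝ`, constrained on `[n₀, N]` only): (6.9) `t_{n₀} = 0`, (6.10) `e_{n₀} = 1`, the
transition-state bounds `StateBounds` for `n₀ ≤ n ≤ N` and the scale-evolution / additional /
energy bounds `StepBounds` for `n₀ < n ≤ N` (these contain `0 = t_{n₀} < t_{n₀+1} < … < t_N` and
`e_n > 0`). [cite: Tao2016AveragedNS, §6.2 Prop. 6.3 (6.9)–(6.25)] -/
structure BlowupCheckpoints (ε₀ K ε : ℝ) (n₀ N : ℤ) (X : Fin 4 → ℤ → ℝ → ℝ) (E : ℤ → ℝ → ℝ)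
    (t e : ℤ → ℝ) : Prop where
  /-- (6.9) `t_{n₀} = 0`. -/
  t_init : t n₀ = 0
  /-- (6.10) `e_{n₀} = 1`. -/
  e_init : e n₀ = 1
  /-- (viii) at every scale `n₀ ≤ n ≤ N`. -/
  state : ∀ n, n₀ ≤ n → n ≤ N → StateBounds ε₀ K ε n₀ X E n (t n) (e n)
  /-- (vii), (6.19)–(6.22), (ix) for every `n₀ < n ≤ N`. -/
  step : ∀ n, n₀ < n → n ≤ N → StepBounds ε₀ K ε X E n (t (n - 1)) (t n) (e (n - 1)) (e n)

/-- **Tao's Proposition 6.3 (blow-up dynamics).** Let the hypotheses and notation be as in Thm. 6.2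
(`0 < ε₀ < 1`, `K` sufficiently large depending on `ε₀`, `ε > 0` sufficiently small depending on
`ε₀, K`, `n₀` sufficiently large depending on `ε₀, K, ε` and the implied constants `C₁, C₂` of
(6.1)–(6.4), (6.7)), and suppose (for contradiction) that `X_{i,n}, E_n` obey (6.0)–(6.8)
(`TaoODESystem`). Let `N ≥ n₀`. Then there exist times `0 ≤ t_{n₀} < … < t_N` and amplitudes
`e_{n₀}, …, e_N > 0` obeying (vi)–(ix), (6.9)–(6.25) (`BlowupCheckpoints`). Proved in the source
by induction from Prop. 6.4 (§6.3–6.7). A named fact (not asserted); see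
`blowupDynamics_of_blowupDynamicsStep`. [cite: Tao2016AveragedNS, §6.2 Prop. 6.3] -/
def blowupDynamics : Prop :=
  ∀ ε₀ : ℝ, 0 < ε₀ → ε₀ < 1 →
    ∃ K₀ : ℝ, ∀ K : ℝ, K₀ ≤ K → 0 < K →
      ∃ e₀ : ℝ, 0 < e₀ ∧ ∀ ε : ℝ, 0 < ε → ε ≤ e₀ →
        ∀ C₁ C₂ : ℝ, 0 ≤ C₁ → 0 ≤ C₂ →
          ∃ N₀ : ℤ, ∀ n₀ : ℤ, N₀ ≤ n₀ →
            ∀ (X : Fin 4 → ℤ → ℝ → ℝ) (E : ℤ → ℝ → ℝ), TaoODESystem ε₀ K ε C₁ C₂ n₀ X E →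
              ∀ N : ℤ, n₀ ≤ N → ∃ t e : ℤ → ℝ, BlowupCheckpoints ε₀ K ε n₀ N X E t e

/-- **Tao's Proposition 6.4 (blow-up dynamics, inductive case).** Same parameter regime and
contradiction hypothesis as Prop. 6.3; assume Prop. 6.3 has been established for some `N ≥ n₀`,
giving times `t_{n₀} < … < t_N` and amplitudes `e_{n₀..N} > 0` with (6.9)–(6.25). Then there exist
a time `t_{N+1} > t_N` and an amplitude `e_{N+1} > 0` obeying (vii′) (6.26)–(6.27), (viii′)
(6.28)–(6.37) and (ix′) (6.38)–(6.40) — in the packaging of this file,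
`StateBounds … (N+1) t_{N+1} e_{N+1}` and `StepBounds … (N+1) t_N t_{N+1} e_N e_{N+1}`. Proved in
the source from Prop. 6.5 by rescaling (§6.4) and a long bootstrap argument (§6.5–6.7). A named
fact (not asserted). [cite: Tao2016AveragedNS, §6.3 Prop. 6.4] -/
def blowupDynamicsStep : Prop :=
  ∀ ε₀ : ℝ, 0 < ε₀ → ε₀ < 1 →
    ∃ K₀ : ℝ, ∀ K : ℝ, K₀ ≤ K → 0 < K →
      ∃ e₀ : ℝ, 0 < e₀ ∧ ∀ ε : ℝ, 0 < ε → ε ≤ e₀ →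
        ∀ C₁ C₂ : ℝ, 0 ≤ C₁ → 0 ≤ C₂ →
          ∃ N₀ : ℤ, ∀ n₀ : ℤ, N₀ ≤ n₀ →
            ∀ (X : Fin 4 → ℤ → ℝ → ℝ) (E : ℤ → ℝ → ℝ), TaoODESystem ε₀ K ε C₁ C₂ n₀ X E →
              ∀ N : ℤ, n₀ ≤ N → ∀ t e : ℤ → ℝ, BlowupCheckpoints ε₀ K ε n₀ N X E t e →
                ∃ s a : ℝ, StateBounds ε₀ K ε n₀ X E (N + 1) s a ∧
                  StepBounds ε₀ K ε X E (N + 1) (t N) s (e N) a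

/-! ## Consequences of the checkpoint bounds: amplitude and time control -/

section Consequences

variable {ε₀ K ε : ℝ} {n₀ N : ℤ} {X : Fin 4 → ℤ → ℝ → ℝ} {E : ℤ → ℝ → ℝ} {t e : ℤ → ℝ}

/-- Lower amplitude bound `e_n ≥ (1+ε₀)^{-(n-n₀)/100}` for `n₀ ≤ n ≤ N`, from (6.10)–(6.11)
(Tao, p. 32: "from (6.13), (6.11), (6.10) we have `|X_{1,N}(t_N)| ≥ (1+ε₀)^{-N/100}`").
[cite: Tao2016AveragedNS, §6.2 p. 32] -/
theorem BlowupCheckpoints.rpow_le_amp (h : BlowupCheckpoints ε₀ K ε n₀ N X E t e) (hε₀ : 0 < ε₀)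
    {n : ℤ} (hn₀ : n₀ ≤ n) (hnN : n ≤ N) :
    (1 + ε₀) ^ (-((n : ℝ) - n₀) / 100) ≤ e n := by
  induction n, hn₀ using Int.leInduction with
  | base => simp [h.e_init]
  | succ n hmn ih =>
    have ih' := ih (by omega)
    have hs := h.step (n + 1) (by omega) hnN
    have h1 : (0 : ℝ) < 1 + ε₀ := by linarith
    have hq : 0 < (1 + ε₀) ^ (-(1 : ℝ) / 100) := Real.rpow_pos_of_pos h1 _
    have hexp : -(((n + 1 : ℤ) : ℝ) - n₀) / 100 = -(1 : ℝ) / 100 + -((n : ℝ) - n₀) / 100 := by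
      push_cast; ring
    calc (1 + ε₀) ^ (-(((n + 1 : ℤ) : ℝ) - n₀) / 100)
        = (1 + ε₀) ^ (-(1 : ℝ) / 100) * (1 + ε₀) ^ (-((n : ℝ) - n₀) / 100) := by
          rw [hexp, Real.rpow_add h1]
      _ ≤ (1 + ε₀) ^ (-(1 : ℝ) / 100) * e n := by gcongr
      _ = (1 + ε₀) ^ (-(1 : ℝ) / 100) * e (n + 1 - 1) := by simp
      _ ≤ e (n + 1) := hs.amp_ge

/-- Upper amplitude bound `e_n ≤ (1+ε₀)^{(n-n₀)/100}` for `n₀ ≤ n ≤ N`, from (6.10)–(6.11).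
[cite: Tao2016AveragedNS, §6.2 p. 32] -/
theorem BlowupCheckpoints.amp_le_rpow (h : BlowupCheckpoints ε₀ K ε n₀ N X E t e) (hε₀ : 0 < ε₀)
    {n : ℤ} (hn₀ : n₀ ≤ n) (hnN : n ≤ N) :
    e n ≤ (1 + ε₀) ^ (((n : ℝ) - n₀) / 100) := by
  induction n, hn₀ using Int.leInduction with
  | base => simp [h.e_init]
  | succ n hmn ih =>
    have ih' := ih (by omega)
    have hs := h.step (n + 1) (by omega) hnN
    have h1 : (0 : ℝ) < 1 + ε₀ := by linarith
    have hq : 0 < (1 + ε₀) ^ ((1 : ℝ) / 100) := Real.rpow_pos_of_pos h1 _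
    calc e (n + 1) ≤ (1 + ε₀) ^ ((1 : ℝ) / 100) * e (n + 1 - 1) := hs.amp_le
      _ = (1 + ε₀) ^ ((1 : ℝ) / 100) * e n := by simp
      _ ≤ (1 + ε₀) ^ ((1 : ℝ) / 100) * (1 + ε₀) ^ (((n : ℝ) - n₀) / 100) := by gcongr
      _ = (1 + ε₀) ^ ((((n + 1 : ℤ) : ℝ) - n₀) / 100) := by
          have hexp : (((n + 1 : ℤ) : ℝ) - n₀) / 100 = (1 : ℝ) / 100 + ((n : ℝ) - n₀) / 100 := by
            push_cast; ring
          rw [hexp, Real.rpow_add h1]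

/-- The amplitudes are positive on `[n₀, N]`. [cite: Tao2016AveragedNS, §6.2 Prop. 6.3] -/
theorem BlowupCheckpoints.amp_pos (h : BlowupCheckpoints ε₀ K ε n₀ N X E t e) {n : ℤ}
    (hn₀ : n₀ ≤ n) (hnN : n ≤ N) : 0 < e n :=
  (h.state n hn₀ hnN).pos

/-- The geometric bound on the checkpoint times used on p. 32: with `q = 1+ε₀`,
`A = 100 q^{-5n₀/2}` and `ρ = q^{-249/100} < 1`, one has
`t_n ≤ A (1 - ρ^{n-n₀}) / (1 - ρ)` for `n₀ ≤ n ≤ N` ("summing the geometric series we have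
`t_N ≤ T` for some finite `T = T_{ε₀}` independent of `N`"). [cite: Tao2016AveragedNS, §6.2 p. 32] -/
theorem BlowupCheckpoints.time_le (h : BlowupCheckpoints ε₀ K ε n₀ N X E t e) (hε₀ : 0 < ε₀)
    {n : ℤ} (hn₀ : n₀ ≤ n) (hnN : n ≤ N) :
    0 ≤ t n ∧ t n ≤ 100 * (1 + ε₀) ^ (-(5 : ℝ) * n₀ / 2) *
      (1 - (1 + ε₀) ^ (-(249 : ℝ) / 100 * (n - n₀))) / (1 - (1 + ε₀) ^ (-(249 : ℝ) / 100)) := by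
  have h1 : (1 : ℝ) < 1 + ε₀ := by linarith
  have h0 : (0 : ℝ) < 1 + ε₀ := by linarith
  have hρ : (1 + ε₀) ^ (-(249 : ℝ) / 100) < 1 :=
    Real.rpow_lt_one_of_one_lt_of_neg h1 (by norm_num)
  have hρ' : 0 < 1 - (1 + ε₀) ^ (-(249 : ℝ) / 100) := by linarith
  induction n, hn₀ using Int.leInduction with
  | base =>
    refine ⟨le_of_eq h.t_init.symm, ?_⟩
    rw [h.t_init]; simp
  | succ n hmn ih =>
    obtain ⟨ih0, ih1⟩ := ih (by omega)
    have hs := h.step (n + 1) (by omega) hnN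
    have hen : (1 + ε₀) ^ (-((n : ℝ) - n₀) / 100) ≤ e n := h.rpow_le_amp hε₀ hmn (by omega)
    have hepos : 0 < e n := h.amp_pos hmn (by omega)
    have hlife := hs.life_le
    have hlt := hs.lt
    simp only [add_sub_cancel_right] at hlife hlt
    refine ⟨by linarith, ?_⟩
    -- the increment `t_{n+1} - t_n ≤ 100 q^{-5n/2} e_n⁻¹ ≤ 100 q^{-5n₀/2} ρ^{n-n₀}`
    have hinc : t (n + 1) - t n ≤
        100 * (1 + ε₀) ^ (-(5 : ℝ) * n₀ / 2) * (1 + ε₀) ^ (-(249 : ℝ) / 100 * (n - n₀)) := by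
      have hcast : (((n + 1 : ℤ) : ℝ) - 1) = (n : ℝ) := by push_cast; ring
      rw [hcast] at hlife
      have hinv : (e n)⁻¹ ≤ (1 + ε₀) ^ (((n : ℝ) - n₀) / 100) := by
        have hpos : 0 < (1 + ε₀) ^ (-((n : ℝ) - n₀) / 100) := Real.rpow_pos_of_pos h0 _
        calc (e n)⁻¹ ≤ ((1 + ε₀) ^ (-((n : ℝ) - n₀) / 100))⁻¹ := inv_anti₀ hpos hen
          _ = (1 + ε₀) ^ (((n : ℝ) - n₀) / 100) := by
              rw [← Real.rpow_neg h0.le]; congr 1; ring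
      calc t (n + 1) - t n ≤ 100 * (1 + ε₀) ^ (-(5 : ℝ) * n / 2) * (e n)⁻¹ := hlife
        _ ≤ 100 * (1 + ε₀) ^ (-(5 : ℝ) * n / 2) * (1 + ε₀) ^ (((n : ℝ) - n₀) / 100) := by
            gcongr
        _ = 100 * (1 + ε₀) ^ (-(5 : ℝ) * n₀ / 2) * (1 + ε₀) ^ (-(249 : ℝ) / 100 * (n - n₀)) := by
            have hexp : -(5 : ℝ) * n / 2 + ((n : ℝ) - n₀) / 100 =
                -(5 : ℝ) * n₀ / 2 + -(249 : ℝ) / 100 * (n - n₀) := by ring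
            rw [mul_assoc, mul_assoc, ← Real.rpow_add h0, ← Real.rpow_add h0, hexp]
    -- sum the geometric series
    have hρn : (1 + ε₀) ^ (-(249 : ℝ) / 100 * (((n + 1 : ℤ) : ℝ) - n₀)) =
        (1 + ε₀) ^ (-(249 : ℝ) / 100) * (1 + ε₀) ^ (-(249 : ℝ) / 100 * (n - n₀)) := by
      have hexp : -(249 : ℝ) / 100 * (((n + 1 : ℤ) : ℝ) - n₀) =
          -(249 : ℝ) / 100 + -(249 : ℝ) / 100 * (n - n₀) := by push_cast; ring
      rw [hexp, Real.rpow_add h0]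
    rw [hρn]
    have hA : 0 ≤ 100 * (1 + ε₀) ^ (-(5 : ℝ) * n₀ / 2) := by positivity
    set A := 100 * (1 + ε₀) ^ (-(5 : ℝ) * n₀ / 2) with hA_def
    set ρ := (1 + ε₀) ^ (-(249 : ℝ) / 100) with hρ_def
    set P := (1 + ε₀) ^ (-(249 : ℝ) / 100 * (n - n₀)) with hP_def
    rw [le_div_iff₀ hρ'] at ih1 ⊢
    nlinarith [ih1, hinc, mul_nonneg hA (le_of_lt hρ')]

/-- A uniform-in-`N` bound: `0 ≤ t_n ≤ T(ε₀, n₀) := 100 (1+ε₀)^{-5n₀/2} / (1 - (1+ε₀)^{-249/100})`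
for `n₀ ≤ n ≤ N` (Tao, p. 32: "`t_N ≤ T` for some finite `T = T_{ε₀}` independent of `N`").
[cite: Tao2016AveragedNS, §6.2 p. 32] -/
theorem BlowupCheckpoints.time_le_uniform (h : BlowupCheckpoints ε₀ K ε n₀ N X E t e)
    (hε₀ : 0 < ε₀) {n : ℤ} (hn₀ : n₀ ≤ n) (hnN : n ≤ N) :
    0 ≤ t n ∧
      t n ≤ 100 * (1 + ε₀) ^ (-(5 : ℝ) * n₀ / 2) / (1 - (1 + ε₀) ^ (-(249 : ℝ) / 100)) := by
  obtain ⟨h0, h1⟩ := h.time_le hε₀ hn₀ hnN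
  refine ⟨h0, h1.trans ?_⟩
  have hq1 : (1 : ℝ) < 1 + ε₀ := by linarith
  have hq0 : (0 : ℝ) < 1 + ε₀ := by linarith
  have hρ : (1 + ε₀) ^ (-(249 : ℝ) / 100) < 1 :=
    Real.rpow_lt_one_of_one_lt_of_neg hq1 (by norm_num)
  have hP : 0 ≤ (1 + ε₀) ^ (-(249 : ℝ) / 100 * (n - n₀)) := (Real.rpow_pos_of_pos hq0 _).le
  have hA : 0 ≤ 100 * (1 + ε₀) ^ (-(5 : ℝ) * n₀ / 2) := by positivity
  rw [div_le_div_iff_of_pos_right (by linarith)]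
  nlinarith

end Consequences

/-! ## Theorem 6.2 from Proposition 6.3 -/

/-- **The last paragraph of Tao's §6.2, pointwise in the parameters**: if `X, E` obey (6.0)–(6.8)
and the blow-up dynamics (6.9)–(6.25) hold up to every level `N ≥ n₀`, contradiction. Printed
argument: the lifespans sum to `t_N ≤ T(ε₀, n₀)` uniformly in `N`, while
`|X_{1,N}(t_N)| = e_N ≥ (1+ε₀)^{-(N-n₀)/100}`, so `(1+(1+ε₀)^{10N})|X_{1,N}(t_N)| → ∞`,
contradicting the a priori bound (6.0) on `[0, T]`. [cite: Tao2016AveragedNS, §6.2 p. 32] -/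
theorem TaoODESystem.false_of_blowupCheckpoints {ε₀ K ε C₁ C₂ : ℝ} {n₀ : ℤ}
    {X : Fin 4 → ℤ → ℝ → ℝ} {E : ℤ → ℝ → ℝ} (hε₀ : 0 < ε₀)
    (hsol : TaoODESystem ε₀ K ε C₁ C₂ n₀ X E)
    (hdyn : ∀ N : ℤ, n₀ ≤ N → ∃ t e : ℤ → ℝ, BlowupCheckpoints ε₀ K ε n₀ N X E t e) : False := by
  have hq1 : (1 : ℝ) < 1 + ε₀ := by linarith
  have hq0 : (0 : ℝ) < 1 + ε₀ := by linarith
  have hρ : (1 + ε₀) ^ (-(249 : ℝ) / 100) < 1 :=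
    Real.rpow_lt_one_of_one_lt_of_neg hq1 (by norm_num)
  -- the uniform time horizon
  set T : ℝ := 100 * (1 + ε₀) ^ (-(5 : ℝ) * n₀ / 2) / (1 - (1 + ε₀) ^ (-(249 : ℝ) / 100)) + 1
    with hT
  have hTpos : 0 < T := by
    have : 0 ≤ 100 * (1 + ε₀) ^ (-(5 : ℝ) * n₀ / 2) / (1 - (1 + ε₀) ^ (-(249 : ℝ) / 100)) :=
      div_nonneg (by positivity) (by linarith)
    linarith
  obtain ⟨M, hM⟩ := hsol.apriori_X T hTpos
  -- `M` bounds `(1+q^{10N}) e_N ≥ q^{(999/100) N + n₀/100}` for every `N ≥ n₀`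
  have hbound : ∀ N : ℤ, n₀ ≤ N → (1 + ε₀) ^ ((999 : ℝ) / 100 * N + n₀ / 100) ≤ M := by
    intro N hN
    obtain ⟨t, e, h⟩ := hdyn N hN
    obtain ⟨ht0, htT⟩ := h.time_le_uniform hε₀ hN le_rfl
    have hst := h.state N hN le_rfl
    have hMN := hM (t N) ⟨ht0, by linarith⟩ 0 N
    rw [hst.x1_eq, abs_of_pos hst.pos] at hMN
    have heN := h.rpow_le_amp hε₀ hN le_rfl
    calc (1 + ε₀) ^ ((999 : ℝ) / 100 * N + n₀ / 100)
        = (1 + ε₀) ^ ((10 : ℝ) * N) * (1 + ε₀) ^ (-((N : ℝ) - n₀) / 100) := by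
          have hexp : (999 : ℝ) / 100 * N + n₀ / 100 = (10 : ℝ) * N + -((N : ℝ) - n₀) / 100 := by
            ring
          rw [hexp, Real.rpow_add hq0]
      _ ≤ (1 + (1 + ε₀) ^ ((10 : ℝ) * N)) * e N := by
          apply mul_le_mul _ heN (Real.rpow_pos_of_pos hq0 _).le (by positivity)
          linarith [Real.rpow_pos_of_pos hq0 ((10 : ℝ) * N)]
      _ ≤ M := hMN
  -- choose `N` so large that the left side exceeds `M` (Bernoulli: `1 + p ε₀ ≤ (1+ε₀)^p`)
  obtain ⟨N, hN⟩ : ∃ N : ℤ, n₀ ≤ N ∧ (max 1 (M / ε₀) + 1 : ℝ) ≤ (999 : ℝ) / 100 * N + n₀ / 100 := by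
    obtain ⟨N, hN⟩ := exists_int_gt (max (n₀ : ℝ) ((max 1 (M / ε₀) + 1 - n₀ / 100) * 100 / 999))
    refine ⟨N, ?_, ?_⟩
    · exact_mod_cast ((le_max_left _ _).trans_lt hN).le
    · have := (le_max_right _ _).trans_lt hN
      nlinarith
  have hp : (1 : ℝ) ≤ (999 : ℝ) / 100 * N + n₀ / 100 := by
    linarith [le_max_left (1 : ℝ) (M / ε₀)]
  have hbern := one_add_mul_self_le_rpow_one_add (s := ε₀) (by linarith) hp
  have hle := hbound N hN.1
  have hMε : M < ((999 : ℝ) / 100 * N + n₀ / 100) * ε₀ := by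
    have h2 : M / ε₀ < (999 : ℝ) / 100 * N + n₀ / 100 := by
      linarith [le_max_right (1 : ℝ) (M / ε₀)]
    rwa [div_lt_iff₀ hε₀] at h2
  linarith

/-- **Thm. 6.2 ⇐ Prop. 6.3** (Tao, §6.2, p. 32): the blow-up dynamics imply that the ODE system
(6.0)–(6.8) has no global solution in the stated parameter regime.
[cite: Tao2016AveragedNS, §6.2 p. 32] -/
theorem noGlobalODESolution_of_blowupDynamics (h : blowupDynamics) : noGlobalODESolution := by
  intro ε₀ hε₀ hε₀1
  obtain ⟨K₀, hK⟩ := h ε₀ hε₀ hε₀1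
  refine ⟨K₀, fun K hK₀K hKpos => ?_⟩
  obtain ⟨e₀, he₀, hε⟩ := hK K hK₀K hKpos
  refine ⟨e₀, he₀, fun ε hεpos hεle C₁ C₂ hC₁ hC₂ => ?_⟩
  obtain ⟨N₀, hN⟩ := hε ε hεpos hεle C₁ C₂ hC₁ hC₂
  refine ⟨N₀, fun n₀ hn₀ => ?_⟩
  rintro ⟨X, E, hsol⟩
  exact hsol.false_of_blowupCheckpoints hε₀ (hN n₀ hn₀ X E hsol)

/-! ## Proposition 6.3 from Proposition 6.4 -/

/-- **Base case of the induction** (Tao, §6.3, p. 32: "one sets `t_{n₀} = 0` and `e_{n₀} = 1`, and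
all the required claims are either vacuously true or follow immediately from the initial
conditions (6.6)"). [cite: Tao2016AveragedNS, §6.3 p. 32] -/
theorem TaoODESystem.blowupCheckpoints_base {ε₀ K ε C₁ C₂ : ℝ} {n₀ : ℤ}
    {X : Fin 4 → ℤ → ℝ → ℝ} {E : ℤ → ℝ → ℝ} (hsol : TaoODESystem ε₀ K ε C₁ C₂ n₀ X E)
    (hε₀ : 0 < ε₀) (hK : 0 < K) (hε : 0 < ε) :
    BlowupCheckpoints ε₀ K ε n₀ n₀ X E (fun _ => 0) (fun _ => 1) where
  t_init := rfl
  e_init := rfl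
  state n hn hn' := by
    obtain rfl : n = n₀ := le_antisymm hn' hn
    refine ⟨one_pos, by simp [hsol.init_X], ?_, ?_, ?_, ?_, ?_⟩
    · simp [hsol.init_X]; positivity
    · simp [hsol.init_X]; positivity
    · simp [hsol.init_X]; positivity
    · simp [hsol.init_X]; positivity
    · simp [hsol.init_E]; positivity
  step n hn hn' := absurd hn' (not_le.mpr hn)

/-- **Inductive step of the induction**: extending checkpoints at level `N` by a pair
`(t_{N+1}, e_{N+1})` as produced by Prop. 6.4 gives checkpoints at level `N+1`.
[cite: Tao2016AveragedNS, §6.3 p. 32] -/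
theorem BlowupCheckpoints.extend {ε₀ K ε : ℝ} {n₀ N : ℤ} {X : Fin 4 → ℤ → ℝ → ℝ}
    {E : ℤ → ℝ → ℝ} {t e : ℤ → ℝ} (h : BlowupCheckpoints ε₀ K ε n₀ N X E t e) (hN : n₀ ≤ N)
    {s a : ℝ} (hst : StateBounds ε₀ K ε n₀ X E (N + 1) s a)
    (hsp : StepBounds ε₀ K ε X E (N + 1) (t N) s (e N) a) :
    BlowupCheckpoints ε₀ K ε n₀ (N + 1) X E (Function.update t (N + 1) s)
      (Function.update e (N + 1) a) where
  t_init := by rw [Function.update_of_ne (by omega)]; exact h.t_init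
  e_init := by rw [Function.update_of_ne (by omega)]; exact h.e_init
  state n hn hn' := by
    rcases lt_or_eq_of_le hn' with hlt | rfl
    · rw [Function.update_of_ne (by omega), Function.update_of_ne (by omega)]
      exact h.state n hn (by omega)
    · rw [Function.update_self, Function.update_self]; exact hst
  step n hn hn' := by
    rcases lt_or_eq_of_le hn' with hlt | rfl
    · rw [Function.update_of_ne (by omega), Function.update_of_ne (by omega),
        Function.update_of_ne (by omega), Function.update_of_ne (by omega)]
      exact h.step n hn (by omega)
    · rw [Function.update_self, Function.update_self, Function.update_of_ne (by omega),
        Function.update_of_ne (by omega), add_sub_cancel_right]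
      exact hsp

/-- **Prop. 6.3 ⇐ Prop. 6.4** (Tao, §6.3, p. 32: "We do so by an induction on `N` … Clearly,
Proposition 6.4 implies Proposition 6.3"). [cite: Tao2016AveragedNS, §6.3 p. 32] -/
theorem blowupDynamics_of_blowupDynamicsStep (h : blowupDynamicsStep) : blowupDynamics := by
  intro ε₀ hε₀ hε₀1
  obtain ⟨K₀, hK⟩ := h ε₀ hε₀ hε₀1
  refine ⟨K₀, fun K hK₀K hKpos => ?_⟩
  obtain ⟨e₀, he₀, hε⟩ := hK K hK₀K hKpos
  refine ⟨e₀, he₀, fun ε hεpos hεle C₁ C₂ hC₁ hC₂ => ?_⟩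
  obtain ⟨N₀, hN⟩ := hε ε hεpos hεle C₁ C₂ hC₁ hC₂
  refine ⟨N₀, fun n₀ hn₀ X E hsol N hNn => ?_⟩
  induction N, hNn using Int.leInduction with
  | base => exact ⟨_, _, hsol.blowupCheckpoints_base hε₀ hKpos hεpos⟩
  | succ N hmn ih =>
    obtain ⟨t, e, hce⟩ := ih
    obtain ⟨s, a, hst, hsp⟩ := hN n₀ hn₀ X E hsol N hmn t e hce
    exact ⟨_, _, hce.extend hmn hst hsp⟩

/-- **Thm. 6.2 ⇐ Prop. 6.4**, the composite of the two reductions of this file.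
[cite: Tao2016AveragedNS, §6.2–6.3] -/
theorem noGlobalODESolution_of_blowupDynamicsStep (h : blowupDynamicsStep) :
    noGlobalODESolution :=
  noGlobalODESolution_of_blowupDynamics (blowupDynamics_of_blowupDynamicsStep h)

end TaoCascade

end Literature.Analysis.FluidPDE
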